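import Summits.QuantumFields.YangMills.Theorems.BalabanLadderNTStrongCouplingRelabel
import Summits.QuantumFields.YangMills.Theorems.ChatterjeeMassGapTorusAxialOneBitBoxIntegral
import HarnessLib

/-!
# Crux `NT` (stmt-QuantumFields-19353), strong-coupling rung `MirrorFloorSU2`: the three TUBE INTEGRALS `κ(T_{ab}) = 2⁻⁸`
# for `SU(2)`

Helper file of the fleet lead prover of crux `NT` (unit `ym-spine-19353-p1`, g17).  The nine plaquette pairs (p at `e₀`, s at
`−e₀`) with a closed completion of at most ten members are completed by one of the three ten-face tubes
`T_{ab} = ∂([−1,1]₀ × [0,1]_a × [0,1]_b)`, `{a,b} ⊂ {1,2,3}` (exact local search; ym-idea-8 g5 `…MirrorPairs` hand count).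
Their Haar integrals for `SU(2)` in the fundamental representation are all `2⁻⁸ = 2^{V−E}` (`V = 12`, `E = 20`):
`tube12_integral`, `tube13_integral`, `tube23_integral` — transported from the tree's ONE box computation
`S28OneBitBox.boxIntegral_plaquetteObs` (`∂([0,2]₀ × [0,1]₁ × [0,1]₂) = T₁₂ + e₀`) by the lattice symmetries
`x ↦ A x − e₀` (`A` = identity, the transposition of axes `2,3`, the cycle `1 → 2 → 3 → 1`) through
`…Relabel.integral_prodCentred_relabel`.  So the expected constant of `MirrorFloorSU2` is `9·2⁻⁸`.
HONEST FRAMING: Haar integrals; nothing about NT or the gap.  [folklore]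
-/

set_option autoImplicit false

noncomputable section

open MeasureTheory
open Literature.MathematicalPhysics.QuantumLattice (ZdPlaquette plaquetteEdges plaquetteObs plaquetteHolonomyZd
  fundamentalRep continuous_fundamentalRep)
open Literature.MathematicalPhysics.QuantumFieldTheory
open Summit.QuantumFields.YangMills.Theorems.S28OneBitBox (boxIntegral_plaquetteObs lt01 lt02 lt12)

namespace Summit.QuantumFields.YangMills.Cruxes.NT.StrongCouplingRung

/-- The tree's box integral in the centred-product currency of `…Relabel` (`m = 0`). [folklore] -/
theorem boxIntegral_centredZero :
    ∫ U, ∏ q ∈ ({(![0,0,0,0], ⟨(1, 2), lt12⟩), (![1,0,0,0], ⟨(0, 1), lt01⟩), (![2,0,0,0], ⟨(1, 2), lt12⟩),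
        (![0,0,0,0], ⟨(0, 1), lt01⟩), (![0,0,1,0], ⟨(0, 1), lt01⟩), (![0,0,0,0], ⟨(0, 2), lt02⟩), (![0,1,0,0], ⟨(0,
        2), lt02⟩), (![1,0,1,0], ⟨(0, 1), lt01⟩), (![1,0,0,0], ⟨(0, 2), lt02⟩), (![1,1,0,0], ⟨(0, 2),
        lt02⟩)} : Finset (ZdPlaquette 4)),
        (((fundamentalRep (Fin 2)) (U.plaquette q.1 q.2.1.1 q.2.1.2)).trace.re - 0)
        ∂zdHaar 4 ↥(Matrix.specialUnitaryGroup (Fin 2) ℂ) = 1 / 256 := by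
  have h := boxIntegral_plaquetteObs
  simp only [plaquetteObs, plaquetteHolonomyZd] at h
  simp only [ZdGaugeConfig.plaquette, sub_zero]
  exact h

/-- **Tube integral `κ(T_{12}) = 2⁻⁸` for `SU(2)`.** [folklore] -/
theorem tube12_integral :
    ∫ U, ∏ p ∈ ({(![-1,0,0,0], ⟨(1, 2), (by decide : (1 : Fin 4) < 2)⟩), (![0,0,0,0], ⟨(0, 1), (by decide : (0 : Fin 4) < 1)⟩), (![1,0,0,0], ⟨(1, 2), (by decide : (1 : Fin 4) < 2)⟩), (![-1,0,0,0], ⟨(0, 1), (by decide : (0 : Fin 4) < 1)⟩), (![-1,0,1,0], ⟨(0, 1), (by decide : (0 : Fin 4) < 1)⟩), (![-1,0,0,0], ⟨(0, 2), (by decide : (0 : Fin 4) < 2)⟩), (![-1,1,0,0], ⟨(0, 2), (by decide : (0 : Fin 4) < 2)⟩), (![0,0,1,0], ⟨(0, 1), (by decide : (0 : Fin 4) < 1)⟩), (![0,0,0,0], ⟨(0, 2), (by decide : (0 : Fin 4) < 2)⟩), (![0,1,0,0], ⟨(0, 2), (by decide : (0 : Fin 4) < 2)⟩)} : Finset (ZdPlaquette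 4)),
        plaquetteObs (fundamentalRep (Fin 2)) p.1 p.2.1.1 p.2.1.2 U ∂zdHaar 4 ↥(Matrix.specialUnitaryGroup (Fin 2) ℂ) = 1 / 256 := by
  classical
  set A : (Fin 4 → ℤ) → (Fin 4 → ℤ) := fun x : (Fin 4 → ℤ) => (![x 0, x 1, x 2, x 3] : Fin 4 → ℤ) with hAd
  set σ : Fin 4 → Fin 4 := ![0,1,2,3] with hσd
  have hA : ∀ x y, A (x + y) = A x + A y := fun x y => by
    rw [hAd]; ext k; fin_cases k <;> simp
  have hAσ : ∀ i, A (Pi.single i 1) = Pi.single (σ i) 1 := fun i => by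
    rw [hAd, hσd]; fin_cases i <;> decide
  have hinj : Function.Injective fun e : ZdEdge 4 => ((A e.1 + ![-1,0,0,0], σ e.2) : ZdEdge 4) := by
    intro e e' h
    simp only [Prod.mk.injEq, add_left_inj] at h
    have h1 : e.1 = e'.1 := by
      have := congrArg (fun y : (Fin 4 → ℤ) => (![y 0, y 1, y 2, y 3] : Fin 4 → ℤ)) h.1
      rw [hAd] at this
      simp at this
      ext k; fin_cases k <;> simp [this]
    have h2 : e.2 = e'.2 := by
      have hs : Function.Injective σ := by rw [hσd]; decide
      exact hs h.2
    exact Prod.ext h1 h2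
  have h := integral_prodCentred_relabel (d := 4) (fundamentalRep (Fin 2)) (continuous_fundamentalRep _) 0
    ({(![0,0,0,0], ⟨(1, 2), lt12⟩), (![1,0,0,0], ⟨(0, 1), lt01⟩), (![2,0,0,0], ⟨(1, 2), lt12⟩),
        (![0,0,0,0], ⟨(0, 1), lt01⟩), (![0,0,1,0], ⟨(0, 1), lt01⟩), (![0,0,0,0], ⟨(0, 2), lt02⟩), (![0,1,0,0], ⟨(0,
        2), lt02⟩), (![1,0,1,0], ⟨(0, 1), lt01⟩), (![1,0,0,0], ⟨(0, 2), lt02⟩), (![1,1,0,0], ⟨(0, 2),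
        lt02⟩)} : Finset (ZdPlaquette 4)) hA hAσ ![-1,0,0,0] hinj
  rw [boxIntegral_centredZero] at h
  rw [← h]
  congr 1
  funext U
  rw [Finset.prod_insert (by decide +kernel), Finset.prod_insert (by decide +kernel),
    Finset.prod_insert (by decide +kernel), Finset.prod_insert (by decide +kernel),
    Finset.prod_insert (by decide +kernel), Finset.prod_insert (by decide +kernel),
    Finset.prod_insert (by decide +kernel), Finset.prod_insert (by decide +kernel),
    Finset.prod_insert (by decide +kernel), Finset.prod_singleton]
  rw [Finset.prod_insert (by decide +kernel), Finset.prod_insert (by decide +kernel),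
    Finset.prod_insert (by decide +kernel), Finset.prod_insert (by decide +kernel),
    Finset.prod_insert (by decide +kernel), Finset.prod_insert (by decide +kernel),
    Finset.prod_insert (by decide +kernel), Finset.prod_insert (by decide +kernel),
    Finset.prod_insert (by decide +kernel), Finset.prod_singleton]
  simp only [(show A ![0,0,0,0] + ![-1,0,0,0] = (![-1,0,0,0] : Fin 4 → ℤ) from by rw [hAd]; decide +kernel),
    (show A ![1,0,0,0] + ![-1,0,0,0] = (![0,0,0,0] : Fin 4 → ℤ) from by rw [hAd]; decide +kernel),
    (show A ![2,0,0,0] + ![-1,0,0,0] = (![1,0,0,0] : Fin 4 → ℤ) from by rw [hAd]; decide +kernel),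
    (show A ![0,0,1,0] + ![-1,0,0,0] = (![-1,0,1,0] : Fin 4 → ℤ) from by rw [hAd]; decide +kernel),
    (show A ![0,1,0,0] + ![-1,0,0,0] = (![-1,1,0,0] : Fin 4 → ℤ) from by rw [hAd]; decide +kernel),
    (show A ![1,0,1,0] + ![-1,0,0,0] = (![0,0,1,0] : Fin 4 → ℤ) from by rw [hAd]; decide +kernel),
    (show A ![1,1,0,0] + ![-1,0,0,0] = (![0,1,0,0] : Fin 4 → ℤ) from by rw [hAd]; decide +kernel),
    (show σ 0 = (0 : Fin 4) from by rw [hσd]; decide), (show σ 1 = (1 : Fin 4) from by rw [hσd]; decide), (show σ 2 = (2 : Fin 4) from by rw [hσd]; decide),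
    sub_zero, plaquetteObs, plaquetteHolonomyZd, ZdGaugeConfig.plaquette]

/-- **Tube integral `κ(T_{13}) = 2⁻⁸` for `SU(2)`.** [folklore] -/
theorem tube13_integral :
    ∫ U, ∏ p ∈ ({(![-1,0,0,0], ⟨(1, 3), (by decide : (1 : Fin 4) < 3)⟩), (![0,0,0,0], ⟨(0, 1), (by decide : (0 : Fin 4) < 1)⟩), (![1,0,0,0], ⟨(1, 3), (by decide : (1 : Fin 4) < 3)⟩), (![-1,0,0,0], ⟨(0, 1), (by decide : (0 : Fin 4) < 1)⟩), (![-1,0,0,1], ⟨(0, 1), (by decide : (0 : Fin 4) < 1)⟩), (![-1,0,0,0], ⟨(0, 3), (by decide : (0 : Fin 4) < 3)⟩), (![-1,1,0,0], ⟨(0, 3), (by decide : (0 : Fin 4) < 3)⟩), (![0,0,0,1], ⟨(0, 1), (by decide : (0 : Fin 4) < 1)⟩), (![0,0,0,0], ⟨(0, 3), (by decide : (0 : Fin 4) < 3)⟩), (![0,1,0,0], ⟨(0, 3), (by decide : (0 : Fin 4) < 3)⟩)} : Finset (ZdPlaquette 4)),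
        plaquetteObs (fundamentalRep (Fin 2)) p.1 p.2.1.1 p.2.1.2 U ∂zdHaar 4 ↥(Matrix.specialUnitaryGroup (Fin 2) ℂ) = 1 / 256 := by
  classical
  set A : (Fin 4 → ℤ) → (Fin 4 → ℤ) := fun x : (Fin 4 → ℤ) => (![x 0, x 1, x 3, x 2] : Fin 4 → ℤ) with hAd
  set σ : Fin 4 → Fin 4 := ![0,1,3,2] with hσd
  have hA : ∀ x y, A (x + y) = A x + A y := fun x y => by
    rw [hAd]; ext k; fin_cases k <;> simp
  have hAσ : ∀ i, A (Pi.single i 1) = Pi.single (σ i) 1 := fun i => by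
    rw [hAd, hσd]; fin_cases i <;> decide
  have hinj : Function.Injective fun e : ZdEdge 4 => ((A e.1 + ![-1,0,0,0], σ e.2) : ZdEdge 4) := by
    intro e e' h
    simp only [Prod.mk.injEq, add_left_inj] at h
    have h1 : e.1 = e'.1 := by
      have := congrArg (fun y : (Fin 4 → ℤ) => (![y 0, y 1, y 3, y 2] : Fin 4 → ℤ)) h.1
      rw [hAd] at this
      simp at this
      ext k; fin_cases k <;> simp [this]
    have h2 : e.2 = e'.2 := by
      have hs : Function.Injective σ := by rw [hσd]; decide
      exact hs h.2
    exact Prod.ext h1 h2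
  have h := integral_prodCentred_relabel (d := 4) (fundamentalRep (Fin 2)) (continuous_fundamentalRep _) 0
    ({(![0,0,0,0], ⟨(1, 2), lt12⟩), (![1,0,0,0], ⟨(0, 1), lt01⟩), (![2,0,0,0], ⟨(1, 2), lt12⟩),
        (![0,0,0,0], ⟨(0, 1), lt01⟩), (![0,0,1,0], ⟨(0, 1), lt01⟩), (![0,0,0,0], ⟨(0, 2), lt02⟩), (![0,1,0,0], ⟨(0,
        2), lt02⟩), (![1,0,1,0], ⟨(0, 1), lt01⟩), (![1,0,0,0], ⟨(0, 2), lt02⟩), (![1,1,0,0], ⟨(0, 2),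
        lt02⟩)} : Finset (ZdPlaquette 4)) hA hAσ ![-1,0,0,0] hinj
  rw [boxIntegral_centredZero] at h
  rw [← h]
  congr 1
  funext U
  rw [Finset.prod_insert (by decide +kernel), Finset.prod_insert (by decide +kernel),
    Finset.prod_insert (by decide +kernel), Finset.prod_insert (by decide +kernel),
    Finset.prod_insert (by decide +kernel), Finset.prod_insert (by decide +kernel),
    Finset.prod_insert (by decide +kernel), Finset.prod_insert (by decide +kernel),
    Finset.prod_insert (by decide +kernel), Finset.prod_singleton]
  rw [Finset.prod_insert (by decide +kernel), Finset.prod_insert (by decide +kernel),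
    Finset.prod_insert (by decide +kernel), Finset.prod_insert (by decide +kernel),
    Finset.prod_insert (by decide +kernel), Finset.prod_insert (by decide +kernel),
    Finset.prod_insert (by decide +kernel), Finset.prod_insert (by decide +kernel),
    Finset.prod_insert (by decide +kernel), Finset.prod_singleton]
  simp only [(show A ![0,0,0,0] + ![-1,0,0,0] = (![-1,0,0,0] : Fin 4 → ℤ) from by rw [hAd]; decide +kernel),
    (show A ![1,0,0,0] + ![-1,0,0,0] = (![0,0,0,0] : Fin 4 → ℤ) from by rw [hAd]; decide +kernel),
    (show A ![2,0,0,0] + ![-1,0,0,0] = (![1,0,0,0] : Fin 4 → ℤ) from by rw [hAd]; decide +kernel),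
    (show A ![0,0,1,0] + ![-1,0,0,0] = (![-1,0,0,1] : Fin 4 → ℤ) from by rw [hAd]; decide +kernel),
    (show A ![0,1,0,0] + ![-1,0,0,0] = (![-1,1,0,0] : Fin 4 → ℤ) from by rw [hAd]; decide +kernel),
    (show A ![1,0,1,0] + ![-1,0,0,0] = (![0,0,0,1] : Fin 4 → ℤ) from by rw [hAd]; decide +kernel),
    (show A ![1,1,0,0] + ![-1,0,0,0] = (![0,1,0,0] : Fin 4 → ℤ) from by rw [hAd]; decide +kernel),
    (show σ 0 = (0 : Fin 4) from by rw [hσd]; decide), (show σ 1 = (1 : Fin 4) from by rw [hσd]; decide), (show σ 2 = (3 : Fin 4) from by rw [hσd]; decide),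
    sub_zero, plaquetteObs, plaquetteHolonomyZd, ZdGaugeConfig.plaquette]

/-- **Tube integral `κ(T_{23}) = 2⁻⁸` for `SU(2)`.** [folklore] -/
theorem tube23_integral :
    ∫ U, ∏ p ∈ ({(![-1,0,0,0], ⟨(2, 3), (by decide : (2 : Fin 4) < 3)⟩), (![0,0,0,0], ⟨(0, 2), (by decide : (0 : Fin 4) < 2)⟩), (![1,0,0,0], ⟨(2, 3), (by decide : (2 : Fin 4) < 3)⟩), (![-1,0,0,0], ⟨(0, 2), (by decide : (0 : Fin 4) < 2)⟩), (![-1,0,0,1], ⟨(0, 2), (by decide : (0 : Fin 4) < 2)⟩), (![-1,0,0,0], ⟨(0, 3), (by decide : (0 : Fin 4) < 3)⟩), (![-1,0,1,0], ⟨(0, 3), (by decide : (0 : Fin 4) < 3)⟩), (![0,0,0,1], ⟨(0, 2), (by decide : (0 : Fin 4) < 2)⟩), (![0,0,0,0], ⟨(0, 3), (by decide : (0 : Fin 4) < 3)⟩), (![0,0,1,0], ⟨(0, 3), (by decide : (0 : Fin 4) < 3)⟩)} : Finset (ZdPlaquette 4)),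
        plaquetteObs (fundamentalRep (Fin 2)) p.1 p.2.1.1 p.2.1.2 U ∂zdHaar 4 ↥(Matrix.specialUnitaryGroup (Fin 2) ℂ) = 1 / 256 := by
  classical
  set A : (Fin 4 → ℤ) → (Fin 4 → ℤ) := fun x : (Fin 4 → ℤ) => (![x 0, x 3, x 1, x 2] : Fin 4 → ℤ) with hAd
  set σ : Fin 4 → Fin 4 := ![0,2,3,1] with hσd
  have hA : ∀ x y, A (x + y) = A x + A y := fun x y => by
    rw [hAd]; ext k; fin_cases k <;> simp
  have hAσ : ∀ i, A (Pi.single i 1) = Pi.single (σ i) 1 := fun i => by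
    rw [hAd, hσd]; fin_cases i <;> decide
  have hinj : Function.Injective fun e : ZdEdge 4 => ((A e.1 + ![-1,0,0,0], σ e.2) : ZdEdge 4) := by
    intro e e' h
    simp only [Prod.mk.injEq, add_left_inj] at h
    have h1 : e.1 = e'.1 := by
      have := congrArg (fun y : (Fin 4 → ℤ) => (![y 0, y 2, y 3, y 1] : Fin 4 → ℤ)) h.1
      rw [hAd] at this
      simp at this
      ext k; fin_cases k <;> simp [this]
    have h2 : e.2 = e'.2 := by
      have hs : Function.Injective σ := by rw [hσd]; decide
      exact hs h.2
    exact Prod.ext h1 h2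
  have h := integral_prodCentred_relabel (d := 4) (fundamentalRep (Fin 2)) (continuous_fundamentalRep _) 0
    ({(![0,0,0,0], ⟨(1, 2), lt12⟩), (![1,0,0,0], ⟨(0, 1), lt01⟩), (![2,0,0,0], ⟨(1, 2), lt12⟩),
        (![0,0,0,0], ⟨(0, 1), lt01⟩), (![0,0,1,0], ⟨(0, 1), lt01⟩), (![0,0,0,0], ⟨(0, 2), lt02⟩), (![0,1,0,0], ⟨(0,
        2), lt02⟩), (![1,0,1,0], ⟨(0, 1), lt01⟩), (![1,0,0,0], ⟨(0, 2), lt02⟩), (![1,1,0,0], ⟨(0, 2),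
        lt02⟩)} : Finset (ZdPlaquette 4)) hA hAσ ![-1,0,0,0] hinj
  rw [boxIntegral_centredZero] at h
  rw [← h]
  congr 1
  funext U
  rw [Finset.prod_insert (by decide +kernel), Finset.prod_insert (by decide +kernel),
    Finset.prod_insert (by decide +kernel), Finset.prod_insert (by decide +kernel),
    Finset.prod_insert (by decide +kernel), Finset.prod_insert (by decide +kernel),
    Finset.prod_insert (by decide +kernel), Finset.prod_insert (by decide +kernel),
    Finset.prod_insert (by decide +kernel), Finset.prod_singleton]
  rw [Finset.prod_insert (by decide +kernel), Finset.prod_insert (by decide +kernel),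
    Finset.prod_insert (by decide +kernel), Finset.prod_insert (by decide +kernel),
    Finset.prod_insert (by decide +kernel), Finset.prod_insert (by decide +kernel),
    Finset.prod_insert (by decide +kernel), Finset.prod_insert (by decide +kernel),
    Finset.prod_insert (by decide +kernel), Finset.prod_singleton]
  simp only [(show A ![0,0,0,0] + ![-1,0,0,0] = (![-1,0,0,0] : Fin 4 → ℤ) from by rw [hAd]; decide +kernel),
    (show A ![1,0,0,0] + ![-1,0,0,0] = (![0,0,0,0] : Fin 4 → ℤ) from by rw [hAd]; decide +kernel),
    (show A ![2,0,0,0] + ![-1,0,0,0] = (![1,0,0,0] : Fin 4 → ℤ) from by rw [hAd]; decide +kernel),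
    (show A ![0,0,1,0] + ![-1,0,0,0] = (![-1,0,0,1] : Fin 4 → ℤ) from by rw [hAd]; decide +kernel),
    (show A ![0,1,0,0] + ![-1,0,0,0] = (![-1,0,1,0] : Fin 4 → ℤ) from by rw [hAd]; decide +kernel),
    (show A ![1,0,1,0] + ![-1,0,0,0] = (![0,0,0,1] : Fin 4 → ℤ) from by rw [hAd]; decide +kernel),
    (show A ![1,1,0,0] + ![-1,0,0,0] = (![0,0,1,0] : Fin 4 → ℤ) from by rw [hAd]; decide +kernel),
    (show σ 0 = (0 : Fin 4) from by rw [hσd]; decide), (show σ 1 = (2 : Fin 4) from by rw [hσd]; decide), (show σ 2 = (3 : Fin 4) from by rw [hσd]; decide),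
    sub_zero, plaquetteObs, plaquetteHolonomyZd, ZdGaugeConfig.plaquette]

end Summit.QuantumFields.YangMills.Cruxes.NT.StrongCouplingRung

end
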